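import Summits.ResolutionOfSingularities.ResolutionOfSingularities.Theorems.MarkedTransferCampaignW46MohWindowShadeFormalNRWalkStep
import Summits.ResolutionOfSingularities.ResolutionOfSingularities.Theorems.MarkedTransferCampaignW46MohWindowShadeFormalNRDescent
import Summits.ResolutionOfSingularities.ResolutionOfSingularities.Theorems.MarkedTransferCampaignW46MohWindowShadeFormalGeomStatement
import Summits.ResolutionOfSingularities.ResolutionOfSingularities.Theorems.MarkedTransferCampaignW46MohWindowShadeFormalInsepTerminates
import Mathlib.FieldTheory.IsAlgClosed.AlgebraicClosure
import HarnessLib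

/-!
# [OURS · L1 W4.6 rung (iii)] The GEOMETRIC formally purely inseparable surface window TERMINATES over EVERY ground field of characteristic
# `p` — no rationality hypothesis on the singular points (closer by name of `…MohWindowShadeFormalGeomStatement.lean`, p557570)

Cell `res-hironaka`, LADDER-RESOLUTION rung L (D-0089), slot W4.6 rung (iii) «purely inseparable `z^p = f(x, y)` with `ord f < 2p`»; seat
res-L1-s46-pv-6 (gen 7). Host route MarkedTransfer (`HypersurfaceOrderReduction`, stmt-ResolutionOfSingularities-16155), `--supports … --as
helper`; kind proof.

WHAT IS PROVED (all OURS; o1's regime of record `regimeMohWindowSurfaceInsep` + «at every singular point, `J𝒪̂ = (z^p + F(u))` in Cohen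
coordinates over SOME perfect coefficient field» = `Regime.mohWindowSurfaceFormalGeom`):
* `mohWindowSurfaceFormalGeomPermissiblyTerminates (p) (K) : MohWindowSurfaceFormalGeomPermissiblyTerminates p K` — THE CLOSER BY NAME, for
  EVERY field `K` of characteristic `p`: no infinite §2.1-permissible sequence all of whose stages lie in the regime.
* `mohWindowSurfaceFormalInsepPermissiblyTerminates_of_perfectField [PerfectField K]` — gen 6's rung (p543815) over EVERY PERFECT field
  (gen 6 had it over algebraically closed and finite fields, and over perfect fields only on `… ∩ Regime.rationalSing`).
* typed rungs `Terminates ∧ TerminatesNabla`; non-vacuity over algebraically closed fields.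
Assembly (HOME/L/res-L1-s46-pv-6/GENERAL-REGIME-ANALYSIS.md §5 done WITHOUT Galois theory): res-L1-s46-pv-1's hit thread; at the root the
regime's anchor over a perfect `L₀`, cleaned (gen 6 brick 1), `Ω = L̄₀`; along the thread the NON-RATIONAL formal step (bricks 1–10 of this
gen: Hensel, grown coefficient fields embedded in `Ω`, the shade model run in `Ω⟦y⟧`); the shade is non-increasing in the window (gen 0/6), so
eventually stalls; by the DEGREE LAW a stall at a point of residue degree `m` forces `m = 1`, so from some stage on the coefficient subfields
`Λ_k ⊆ Ω` stop growing and the digits of the thread lie in them; this seat's gen-3/6 model theorem over `Ω` gives a formal `p`-fold curve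
`(y_i − ψ(y_j))^p ∣ F_n ⊗ Ω` with `ψ` over `Λ_n`; the shear descent (brick 9) reads it in `L_n⟦z, u⟧`; res-D-pv-050's exit door. NOT CLAIMED:
the non-purely-inseparable members of o1's regime (res-L1-s46-pv-5's W-walk programme); imperfect residue fields (excluded by the regime's
perfectness clause, DESIGN POINT (PERF) of the statement file); anything about the manuscript. H. Hironaka, ms. 2017-03-23, Th. 16.6 p.84,
Th. 16.13 p.87 — scope only, under adjudication [Hironaka2017]. AI-written; AI review is weaker than expert review. References: H. Hauser,
Bull. AMS 47 (2010) §§F–G; Stacks Project Tag 0804; H. Matsumura (1986) Thm. 28.3. [Hauser2010] [StacksProject] [Matsumura1987] [folklore]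
-/

noncomputable section

set_option linter.dupNamespace false -- mandated namespace of this single-conjunct summit

open CategoryTheory AlgebraicGeometry TopologicalSpace IsLocalRing MvPolynomial

namespace Summit.ResolutionOfSingularities.ResolutionOfSingularities.Theorems

namespace CampaignW46

namespace MohWindowShadeFormalNR

open Literature.AlgebraicGeometry.Resolution
open Literature.AlgebraicGeometry.Resolution.PointBlowup
open Literature.AlgebraicGeometry.Resolution.Hauser2010
open Literature.AlgebraicGeometry.Hironaka2017.S02Preliminaries
open Literature.AlgebraicGeometry.Hironaka2017.Datum
open Scheme.IdealSheafData
open MohWindowShadePS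
open MohWindowShadeCleaning (eq_single_add_single)

variable {p : ℕ} [hp : Fact p.Prime] {K : Type} [Field K] [CharP K p]

/-! ## §1 The walk along a hit thread in `Ω⟦y⟧` -/

section Walk

variable {Ω : Type} [Field Ω] [IsAlgClosed Ω] [DecidableEq Ω] [CharP Ω p]

omit hp [IsAlgClosed Ω] [DecidableEq Ω] [CharP Ω p] in
/-- The coefficient map of a digit series. [folklore] -/
theorem map_digitSeries {L : Type} [Field L] (ι : L →+* Ω) (j i : Fin 2) (t : ℕ → L) :
    MvPowerSeries.map ι (MohWindowShadeFormalBranch.digitSeries j i t) = MohWindowShadeFormalBranch.digitSeries j i (fun k => ι (t k)) := by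
  ext e
  rw [MvPowerSeries.coeff_map, MohWindowShadeFormalBranch.coeff_digitSeries, MohWindowShadeFormalBranch.coeff_digitSeries]
  split_ifs <;> simp

/-- **THE NON-RATIONAL ENTRANCE DOOR CLOSES ON THE EXIT DOOR.** [OURS · L1 W4.6 rung (iii-2)] NOT a statement of the manuscript. An infinite
§2.1-permissible sequence inside o1's regime `regimeMohWindowSurfaceInsep` with a hit thread whose root carries a CLEANED series anchor over a
perfect field embedded in an algebraically closed `Ω` does not exist. [cite: Hauser2010, §F (setting f = x^p + y^r g)] [cite: StacksProject, Tag 0804] -/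
theorem false_of_hitThread_formalNRAnchor (r : PermissibleRun p K)
    (hr : ∀ k, regimeMohWindowSurfaceInsep (p := p) (K := K) (r.A k) (r.E k)) (t : r.HitThread) (s₀ : Series (Fin 2) Ω) (hs₀r : s₀.r = 0)
    (hclean : IsClean p s₀.F) (Λ₀ : Subfield Ω)
    (hA0 : ∃ (L : Type) (_ : Field L) (_ : CharP L p) (_ : PerfectField L) (ι : L →+* Ω)
      (e : AdicCompletion (maximalIdeal ((r.A 0).Z.presheaf.stalk (t.y 0))) ((r.A 0).Z.presheaf.stalk (t.y 0)) ≃+* MvPowerSeries (Option (Fin 2)) L)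
      (f₀ : (r.A 0).Z.presheaf.stalk (t.y 0)) (w : MvPowerSeries (Option (Fin 2)) L) (F : MvPowerSeries (Fin 2) L),
      ι.fieldRange = Λ₀ ∧ stalkIdeal (r.E 0).J (t.y 0) = Ideal.span {f₀} ∧ IsUnit w ∧
        e (algebraMap _ _ f₀) = w * (MvPowerSeries.X none ^ p + MvPowerSeries.rename (some : Fin 2 → Option (Fin 2)) F) ∧
        MvPowerSeries.map ι F = s₀.F) :
    False := by
  classical
  -- the anchor predicate at stage `k` for a model state and a coefficient subfield
  let Anch : ∀ k, Series (Fin 2) Ω × Subfield Ω → Prop := fun k q => IsClean p q.1.F ∧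
    ∃ (L : Type) (_ : Field L) (_ : CharP L p) (_ : PerfectField L) (ι : L →+* Ω)
      (e : AdicCompletion (maximalIdeal ((r.A k).Z.presheaf.stalk (t.y k))) ((r.A k).Z.presheaf.stalk (t.y k)) ≃+* MvPowerSeries (Option (Fin 2)) L)
      (f₀ : (r.A k).Z.presheaf.stalk (t.y k)) (w : MvPowerSeries (Option (Fin 2)) L) (F : MvPowerSeries (Fin 2) L),
      ι.fieldRange = q.2 ∧ stalkIdeal (r.E k).J (t.y k) = Ideal.span {f₀} ∧ IsUnit w ∧
        e (algebraMap _ _ f₀) = w * (MvPowerSeries.X none ^ p + MvPowerSeries.rename (some : Fin 2 → Option (Fin 2)) F) ∧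
        MvPowerSeries.map ι F = q.1.F
  have G : ∀ (k : ℕ) (P : {q : Series (Fin 2) Ω × Subfield Ω // Anch k q}),
      ∃ (Q : {q : Series (Fin 2) Ω × Subfield Ω // Anch (k + 1) q}) (c : Fin 2) (b : Fin 2 → Ω),
        ((r.D k : Set (r.A k).Z) = {t.y k} → Q.1.1 = P.1.1.step p c b ∧ b c = 0 ∧ (c = 1 → ∀ l, b l = 0) ∧
          P.1.1.IsEquimultiplePoint p c b ∧
          (∀ c', c' ≠ c → IsClean p P.1.1.F → Divides P.1.1.r P.1.1.F → ¬ P.1.1.ShadeDrops p c b → b c' ∈ P.1.2) ∧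
          (∀ c', c' ≠ c → b c' ∈ P.1.2 → Q.1.2 ≤ P.1.2)) ∧
        ((r.D k : Set (r.A k).Z) ≠ {t.y k} → Q.1.1 = P.1.1 ∧ Q.1.2 = P.1.2) := by
    intro k P
    obtain ⟨s', Λ', c, b, h1, h2, hA'⟩ := formalNRAnchor_succ r hr t k P.1.1 P.1.2 P.2.1 P.2.2
    have hcl' : IsClean p s'.F := by
      by_cases hhit : (r.D k : Set (r.A k).Z) = {t.y k}
      · rw [(h1 hhit).1]; exact Series.isClean_step p c b _
      · rw [(h2 hhit).1]; exact P.2.1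
    exact ⟨⟨(s', Λ'), hcl', hA'⟩, c, b, h1, h2⟩
  choose next nc nb hnext using G
  let seq : ∀ k, {q : Series (Fin 2) Ω × Subfield Ω // Anch k q} :=
    fun k => Nat.rec (motive := fun k => {q : Series (Fin 2) Ω × Subfield Ω // Anch k q}) ⟨(s₀, Λ₀), hclean, hA0⟩ (fun k P => next k P) k
  have hseq : ∀ k, seq (k + 1) = next k (seq k) := fun k => rfl
  have hseq0 : (seq 0).1 = (s₀, Λ₀) := rfl
  -- the hit stages
  set P : ℕ → Prop := fun k => (r.D k : Set (r.A k).Z) = {t.y k} with hP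
  have hinf : (setOf P).Infinite :=
    Nat.frequently_atTop_iff_infinite.mp (Filter.frequently_atTop.mpr fun a => t.hit a)
  have hPnth : ∀ n, P (Nat.nth P n) := Nat.nth_mem_of_infinite hinf
  have hgap : ∀ n m, Nat.nth P n < m → m < Nat.nth P (n + 1) → ¬ P m := by
    intro n m h1 h2 hm
    obtain ⟨i, -, hi⟩ := Nat.exists_lt_card_nth_eq hm
    rw [← hi] at h1 h2
    have := (Nat.nth_lt_nth hinf).mp h1
    have := (Nat.nth_lt_nth hinf).mp h2
    omega
  have hgap0 : ∀ m, m < Nat.nth P 0 → ¬ P m := by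
    intro m h hm
    obtain ⟨i, -, hi⟩ := Nat.exists_lt_card_nth_eq hm
    rw [← hi] at h
    have := (Nat.nth_lt_nth hinf).mp h
    omega
  -- the state is constant off the hit stages
  have hstay : ∀ m, ¬ P m → (seq (m + 1)).1 = (seq m).1 := fun m hm => by
    rw [hseq]; exact Prod.ext ((hnext m (seq m)).2 hm).1 ((hnext m (seq m)).2 hm).2
  have hconst : ∀ n d, Nat.nth P n + 1 + d ≤ Nat.nth P (n + 1) →
      (seq (Nat.nth P n + 1 + d)).1 = (seq (Nat.nth P n + 1)).1 := by
    intro n d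
    induction d with
    | zero => intro _; rfl
    | succ d ih =>
      intro hle
      have h1 : (seq (Nat.nth P n + 1 + d + 1)).1 = (seq (Nat.nth P n + 1 + d)).1 :=
        hstay _ (hgap n _ (by omega) (by omega))
      rw [← ih (by omega), ← h1]
      rfl
  have hconst0 : ∀ d, d ≤ Nat.nth P 0 → (seq d).1 = (seq 0).1 := by
    intro d
    induction d with
    | zero => intro _; rfl
    | succ d ih =>
      intro hle
      rw [hstay d (hgap0 d (by omega))]
      exact ih (by omega)
  -- the model walk and the subfields
  set sM : ℕ → Series (Fin 2) Ω := fun n => (seq (Nat.nth P n)).1.1 with hsM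
  set ΛM : ℕ → Subfield Ω := fun n => (seq (Nat.nth P n)).1.2 with hΛM
  set cM : ℕ → Fin 2 := fun n => nc (Nat.nth P n) (seq (Nat.nth P n)) with hcM
  set bM : ℕ → Fin 2 → Ω := fun n => nb (Nat.nth P n) (seq (Nat.nth P n)) with hbM
  have hhitrel : ∀ n, (seq (Nat.nth P n + 1)).1.1 = (sM n).step p (cM n) (bM n) ∧ bM n (cM n) = 0 ∧
      (cM n = 1 → ∀ l, bM n l = 0) ∧ (sM n).IsEquimultiplePoint p (cM n) (bM n) ∧
      (∀ c', c' ≠ cM n → IsClean p (sM n).F → Divides (sM n).r (sM n).F → ¬ (sM n).ShadeDrops p (cM n) (bM n) → bM n c' ∈ ΛM n) ∧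
      (∀ c', c' ≠ cM n → bM n c' ∈ ΛM n → (seq (Nat.nth P n + 1)).1.2 ≤ ΛM n) := by
    intro n
    have h := (hnext (Nat.nth P n) (seq (Nat.nth P n))).1 (hPnth n)
    rw [← hseq] at h
    exact h
  have hnext_stage : ∀ n, (seq (Nat.nth P (n + 1))).1 = (seq (Nat.nth P n + 1)).1 := by
    intro n
    obtain ⟨d, hd⟩ : ∃ d, Nat.nth P (n + 1) = Nat.nth P n + 1 + d := ⟨Nat.nth P (n + 1) - (Nat.nth P n + 1), by
      have hlt : Nat.nth P n < Nat.nth P (n + 1) := (Nat.nth_lt_nth hinf).mpr (Nat.lt_succ_self n); omega⟩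
    rw [hd]; exact hconst n d (by omega)
  have hstepM : ∀ n, sM (n + 1) = (sM n).step p (cM n) (bM n) := by
    intro n
    rw [← (hhitrel n).1]
    show (seq (Nat.nth P (n + 1))).1.1 = _
    rw [hnext_stage n]
  have hΛsucc : ∀ n, ΛM (n + 1) = (seq (Nat.nth P n + 1)).1.2 := by
    intro n
    show (seq (Nat.nth P (n + 1))).1.2 = _
    rw [hnext_stage n]
  have hwinM : ∀ n, (p : ℕ∞) ≤ (sM n).F.order ∧ (sM n).F.order < (2 * p : ℕ) := by
    intro n
    obtain ⟨-, L, _i1, _i2, _i3, ι, e, f₀, w, F, -, hJ, hw, hE, hsF⟩ := (seq (Nat.nth P n)).2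
    have h := window_of_formalNRAnchor (hr _) (t.mem _) e hJ hw F hE
    rw [show (sM n).F = MvPowerSeries.map ι F from hsF.symm, order_map_of_injective ι ι.injective]
    exact h
  have hsM0 : sM 0 = s₀ := by
    show (seq (Nat.nth P 0)).1.1 = _
    rw [hconst0 _ le_rfl, hseq0]
  have hij : (1 : Fin 2) ≠ 0 := by decide
  have htwo : ∀ l : Fin 2, l = 0 ∨ l = 1 := fun l => by fin_cases l <;> simp
  have hclean0 : IsClean p (sM 0).F := by rw [hsM0]; exact hclean
  have hr0 : Divides (sM 0).r (sM 0).F := by rw [hsM0, hs₀r]; intro d _; exact bot_le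
  have hinv := Series.invariants_of_walk p hij htwo sM cM bM (fun n => (hhitrel n).2.1) hstepM hclean0 hr0 (fun n => (hhitrel n).2.2.2.1) hwinM
  -- the shade eventually stalls
  choose o ho hlo hhi using fun n => (hinv n).2.2
  have hshade : ∀ n, (sM n).shade = ((o n - (sM n).r.degree : ℕ) : ℕ∞) := fun n => (sM n).shade_eq_of_order_eq (ho n)
  set a : ℕ → ℕ := fun n => o n - (sM n).r.degree with ha
  have hsucc : ∀ n, a (n + 1) ≤ a n := by
    intro n
    have hle : (sM (n + 1)).shade ≤ (sM n).shade := by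
      rw [hstepM n]
      exact (sM n).shade_step_le p (cM n) (bM n) ((hhitrel n).2.1) (hinv n).1 (ho n) (hlo n).le (hhi n) (hinv n).2.1
        ((hhitrel n).2.2.2.1) (o' := o (n + 1)) (by rw [← hstepM n]; exact ho _) (hhi (n + 1))
    rw [hshade, hshade] at hle
    exact_mod_cast hle
  have hanti : Antitone a := antitone_nat_of_succ_le hsucc
  set n₀ := Function.argmin a with hn₀
  have hmin : ∀ n, a n₀ ≤ a n := fun n => not_lt.mp (Function.not_lt_argmin a n)
  have hstall : ∀ n, n₀ ≤ n → ¬ (sM n).ShadeDrops p (cM n) (bM n) := by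
    intro n hn hdrop
    unfold Series.ShadeDrops at hdrop
    rw [← hstepM, hshade, hshade] at hdrop
    have h1 : a (n + 1) < a n := by exact_mod_cast hdrop
    exact absurd (lt_of_lt_of_le h1 (hanti hn)) (not_lt.mpr (hmin (n + 1)))
  -- from `n₀` on the digits lie in the (shrinking) coefficient subfields
  have hdigit : ∀ n, n₀ ≤ n → bM n 1 ∈ ΛM n := by
    intro n hn
    by_cases hc : cM n = 1
    · rw [(hhitrel n).2.2.1 hc 1]; exact Subfield.zero_mem _
    · exact (hhitrel n).2.2.2.2.1 1 (fun h => hc h.symm) (hinv n).1 (hinv n).2.1 (hstall n hn)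
  have hΛanti : ∀ n, n₀ ≤ n → ΛM (n + 1) ≤ ΛM n := by
    intro n hn
    rw [hΛsucc n]
    by_cases hc : cM n = 1
    · exact (hhitrel n).2.2.2.2.2 0 (by rw [hc]; decide) (by rw [(hhitrel n).2.2.1 hc 0]; exact Subfield.zero_mem _)
    · have hc0 : cM n = 0 := by rcases htwo (cM n) with h | h; exact h; exact absurd h hc
      exact (hhitrel n).2.2.2.2.2 1 (by rw [hc0]; decide) (hdigit n hn)
  have hΛle : ∀ n d, n₀ ≤ n → ΛM (n + d) ≤ ΛM n := by
    intro n d hn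
    induction d with
    | zero => exact le_rfl
    | succ d ih => exact (hΛanti (n + d) (by omega)).trans ih
  -- the tail walk from `n₀` meets a formal `p`-fold curve
  obtain ⟨n₁, hcurve⟩ := Series.exists_coordinate_or_digit_curve_of_walk p hij htwo (fun k => sM (n₀ + k)) (fun k => cM (n₀ + k))
    (fun k => bM (n₀ + k)) (fun k => (hhitrel _).2.1) (fun k => (hhitrel _).2.2.1)
    (fun k => by show sM (n₀ + (k + 1)) = _; rw [show n₀ + (k + 1) = n₀ + k + 1 by omega]; exact hstepM _)
    (hinv n₀).1 (hinv n₀).2.1 (fun k => (hhitrel _).2.2.2.1) (fun k => hwinM _)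
  -- the anchor at that stage
  set κ := Nat.nth P (n₀ + n₁) with hκ
  obtain ⟨-, L, _i1, _i2, _i3, ι, e, f₀, w, F, hΛ, hJ, hw, hE, hsF⟩ := (seq κ).2
  obtain ⟨-, -, -, -, hb⟩ := MohWindowShadeAnchorWalk.regime_point (hr κ) (t.mem κ)
  have hsFn : MvPowerSeries.map ι F = (sM (n₀ + n₁)).F := hsF
  rcases hcurve with ⟨l, W, hF⟩ | ⟨W, hF⟩
  · -- coordinate `p`-th power: descend with `ψ = 0`
    obtain ⟨l', hl', -⟩ := MohWindowShadeFormalStep.exists_other_index l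
    obtain ⟨W', hW'⟩ := exists_eq_pow_mul_of_map ι (j := l') (i := l) (Ne.symm hl') p 0 (by simp) (fun e he => absurd (by simp) he) F W
      (by rw [hsFn, map_zero, sub_zero]; exact hF)
    rw [sub_zero] at hW'
    exact not_regime_of_formalNRAnchor_coordinate (r.A κ) (r.E κ) (t.y κ) hb e hJ hw l W' hW' hE (hr κ)
  · -- digit branch: the digits lie in `Λ_κ = ι(L)`
    have hdig : ∀ k, bM (n₀ + n₁ + k) 1 ∈ ι.fieldRange := by
      intro k
      rw [hΛ]
      exact hΛle (n₀ + n₁) k (by omega) (hdigit _ (by omega))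
    choose tL htL using hdig
    set ψL := MohWindowShadeFormalBranch.digitSeries (0 : Fin 2) 1 tL with hψL
    have hψmap : MvPowerSeries.map ι ψL = MohWindowShadeFormalBranch.digitSeries (0 : Fin 2) 1 (fun k => bM (n₀ + (n₁ + k)) 1) := by
      rw [hψL, map_digitSeries]
      congr 1
      funext k
      rw [htL k, show n₀ + n₁ + k = n₀ + (n₁ + k) by omega]
    have hψ0 : MvPowerSeries.constantCoeff ψL = 0 := by
      rw [← MvPowerSeries.coeff_zero_eq_constantCoeff_apply, hψL, MohWindowShadeFormalBranch.coeff_digitSeries]; simp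
    have hψsupp : ∀ e, MvPowerSeries.coeff e ψL ≠ 0 → e = Finsupp.single (0 : Fin 2) (e 0) := by
      intro e he
      rw [hψL, MohWindowShadeFormalBranch.coeff_digitSeries] at he
      split_ifs at he with h
      · rw [eq_single_add_single hij htwo e, h.1, Finsupp.single_zero, add_zero]
        simp
      · exact absurd rfl he
    obtain ⟨W', hW'⟩ := exists_eq_pow_mul_of_map ι (j := (0 : Fin 2)) (i := 1) hij p ψL hψ0 hψsupp F W (by rw [hsFn, hψmap]; exact hF)
    exact not_regime_of_formalNRAnchor_digit (r.A κ) (r.E κ) (t.y κ) hb e hJ hw tL W' hW' hE (hr κ)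

end Walk

/-! ## §2 The root: the regime's anchor over a perfect field, cleaned; `Ω` its algebraic closure -/

/-- **No hit thread rooted at a geometrically formally purely inseparable point.** [OURS · L1 W4.6 rung (iii)] NOT a statement of the
manuscript. [cite: Hauser2010, §G (cleaning of p-th power monomials)] -/
theorem false_of_hitThread_formalGeomAt (r : PermissibleRun p K)
    (hr : ∀ k, regimeMohWindowSurfaceInsep (p := p) (K := K) (r.A k) (r.E k)) (t : r.HitThread)
    (h0 : MohWindowSurfaceFormalGeomAt p ((r.A 0).Z.presheaf.stalk (t.y 0)) (stalkIdeal (r.E 0).J (t.y 0))) : False := by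
  classical
  obtain ⟨L, _iF, _iC, _iP, e, f₀, w, F, hJ, hw, hE⟩ := h0
  haveI : PerfectRing L p := PerfectField.toPerfectRing p
  obtain ⟨hR, -, -, -, hb⟩ := MohWindowShadeAnchorWalk.regime_point (hr 0) (t.mem 0)
  haveI := hR
  have hf₀ : f₀ ∈ maximalIdeal ((r.A 0).Z.presheaf.stalk (t.y 0)) := by
    have h := (le_idealOrder_iff (r.E 0).J (t.y 0) (r.E 0).b).mp (t.mem 0)
    rw [hJ, Ideal.span_singleton_le_iff_mem, hb] at h
    exact Ideal.pow_le_self hp.out.ne_zero h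
  obtain ⟨e', w', F', hw', hclean, -, hE'⟩ := MohWindowShadeFormalInsep.exists_clean_formalInsepAnchor p e hf₀ hw F hE
  -- the algebraic closure and the root anchor read in it
  set Ω := AlgebraicClosure L
  set ι : L →+* Ω := algebraMap L (AlgebraicClosure L) with hι
  haveI : CharP Ω p := charP_of_injective_ringHom ι.injective p
  exact false_of_hitThread_formalNRAnchor (Ω := Ω) r hr t ⟨MvPowerSeries.map ι F', 0⟩ rfl
    (fun d hd => by rw [MvPowerSeries.coeff_map, hclean d hd, map_zero]) ι.fieldRange
    ⟨L, _iF, _iC, _iP, ι, e', f₀, w', F', rfl, hJ, hw', hE', rfl⟩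

/-! ## §3 The closers -/

/-- **No hit thread in the geometric formally purely inseparable surface window regime**, EVERY ground field of characteristic `p`.
[OURS · L1 W4.6 rung (iii)] NOT a statement of the manuscript. [cite: StacksProject, Tag 0804] -/
theorem mohWindowSurfaceFormalGeom_noHitThread : NoHitThread (Regime.mohWindowSurfaceFormalGeom (p := p) (K := K)) := by
  intro r hr t
  exact false_of_hitThread_formalGeomAt r (fun k => (hr k).1) t ((hr 0).2 (t.y 0) (t.mem 0))

variable (p) (K)

/-- **RUNG (iii), GEOMETRIC FORMALLY PURELY INSEPARABLE SURFACE WINDOW — CLOSED BY NAME over EVERY field of characteristic `p`.**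
[OURS · L1 W4.6 rung (iii)] NOT a statement of the manuscript: `MohWindowSurfaceFormalGeomPermissiblyTerminates p K` — no infinite
§2.1-permissible sequence inside `Regime.mohWindowSurfaceFormalGeom` (o1's purely inseparable surface window whose singular germs are
`z^p + F(u₀, u₁)` in Cohen coordinates over a perfect coefficient field OF THE POINT, `F` ANY power series); no rationality hypothesis on the
singular points. [cite: Hauser2010, §F (setting f = x^p + y^r g)] [cite: StacksProject, Tag 0804] -/
theorem mohWindowSurfaceFormalGeomPermissiblyTerminates : MohWindowSurfaceFormalGeomPermissiblyTerminates p K :=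
  permissiblyTerminates_of_noHitThread (fun A E h => ((regimeMohWindowSurfaceInsep_iff A E).mp h.1).1.1) mohWindowSurfaceFormalGeom_noHitThread

/-- **RUNG (iii), FORMALLY PURELY INSEPARABLE SURFACE WINDOW (gen 6, p543815) — now over EVERY PERFECT FIELD** (gen 6: algebraically closed,
finite; perfect only on `… ∩ rationalSing`). [OURS · L1 W4.6 rung (iii)] NOT a statement of the manuscript. [folklore] -/
theorem mohWindowSurfaceFormalInsepPermissiblyTerminates_of_perfectField [PerfectField K] : MohWindowSurfaceFormalInsepPermissiblyTerminates p K :=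
  mohWindowSurfaceFormalInsepPermissiblyTerminates_of_geom (mohWindowSurfaceFormalGeomPermissiblyTerminates p K)

/-- **The typed rungs**, every ground field: for EVERY notion instance `N` and reading `Rd`, the typed Th. 16.6 procedure with the literal centre
rule (`Terminates`) and the ∇-centred one (`TerminatesNabla`) have no infinite run inside `Regime.mohWindowSurfaceFormalGeom`. [OURS · L1 W4.6
rung (iii)] NOT a statement of the manuscript. [folklore] -/
theorem terminates_mohWindowSurfaceFormalGeom (n : ℕ) (N : Notions.{0} n) (Rd : Reading p K N) :
    Terminates N Rd (Regime.mohWindowSurfaceFormalGeom (p := p) (K := K)) ∧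
      TerminatesNabla N Rd (Regime.mohWindowSurfaceFormalGeom (p := p) (K := K)) :=
  terminates_and_terminatesNabla_of_mohWindowSurfaceFormalGeomPermissiblyTerminates (mohWindowSurfaceFormalGeomPermissiblyTerminates p K) n N Rd

/-! ## §4 Non-vacuity -/

/-- **NON-VACUITY of the geometric regime** (algebraically closed `K`): gen 4's kernel witness `((z^p + x^(p+1) + y^(p+1))·𝒪, p)` on `𝔸³_K`
is a standard state of `Regime.mohWindowSurfaceFormalGeom` with non-empty singular locus. [OURS · L1 W4.6 rung (iii)] NOT a statement of the
manuscript. [folklore] -/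
theorem exists_singular_state_mohWindowSurfaceFormalGeom [IsAlgClosed K] :
    ∃ (A : AmbientDatum p K) (E : IdealExponent A.Z),
      Regime.mohWindowSurfaceFormalGeom (p := p) (K := K) A E ∧ E.IsStandard ∧ E.sing.Nonempty := by
  haveI : PerfectField K := IsAlgClosed.perfectField K
  obtain ⟨A, E, hRg, hst, hne⟩ := exists_singular_state_mohWindowSurfaceFormalInsep p K
  exact ⟨A, E, Regime.mohWindowSurfaceFormalInsep_le_formalGeom A E hRg, hst, hne⟩

end MohWindowShadeFormalNR

end CampaignW46

end Summit.ResolutionOfSingularities.ResolutionOfSingularities.Theorems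

end
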